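import Literature.AlgebraicGeometry.Motives.AbelianVarietyWeilPairingGalois
import HarnessLib

/-!
# Galois transport of the level Weil pairing for a NON-invariant divisor: `ē_N^Θ(σ r, σ s) = σ (ē_N^{(gal σ)^* Θ}(r, s))`

Layer `Literature/AlgebraicGeometry/Motives`, namespace `Literature.AlgebraicGeometry.Motives.AbelianVariety`; sequel of ★
`AbelianVarietyWeilPairingGalois` (`weilPairingLevel_galSmul`: the same identity for a Galois-INVARIANT `Θ`).  THEOREMS ONLY (no
definition, no instance, no named fact, no `sorry`).

For an abelian variety `P / K`, a field extension `L / K`, `Y = P_L`, `σ ∈ Aut(L/K)` acting on `Y` by `gal σ = 1 × Spec σ⁻¹` (★ `galX`)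
and on `P(L)`, and ANY Cartier divisor `Θ` on `Y`: the level-`N` Weil pairings of `Θ` and of its Galois conjugate `(gal σ)^* Θ` satisfy
**`ē_N^Θ(σ r, σ s) = σ (ē_N^{(gal σ)^* Θ}(r, s))`** (`weilPairingLevel_galSmul_pullback`) — Milne 1986 §16 (p. 131: the `ē_m` are
pairings of Galois modules, for the divisor transported along with the points), Lang VII §2 (the pairing commutes with automorphisms of
the universal domain).  The invariant case `(gal σ)^* Θ ∼ Θ` of ★ `weilPairingLevel_galSmul` follows by ★ `weilPairingLevel_congr_sameDivisor`;
the present form is what a consumer needs when `Θ` is Galois invariant only up to translation / linear equivalence (e.g. a Riemann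
theta divisor on a Jacobian), the invariance being then supplied at the level of PAIRINGS (`weilPairingLevel_galSmul_of_pairing_invariant`).

* `pullback_galX_galX_symm_sameDivisor` — `(gal σ⁻¹)^* (gal σ)^* Θ ∼ Θ`;
* `weilDiv_smul_sameDivisor_pullback` — `D_{σ s}(Θ) ∼ (gal σ⁻¹)^* D_s((gal σ)^* Θ)` for every `Θ` (★ `weilDiv_smul_sameDivisor` without
  the invariance hypothesis);
* **`weilPairingLevel_galSmul_pullback`** — the displayed identity (★ `weilPairingLevel_galSmul`'s proof with the trivializer of
  `D_s((gal σ)^* Θ)`);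
* `weilPairingLevel_galSmul_of_pairing_invariant` — `ē_N^Θ(σ r, σ s) = σ (ē_N^Θ(r, s))` from the PAIRING-level invariance
  `ē_N^{(gal σ)^* Θ} = ē_N^Θ`.

Cell `hodgecm-mathlib` (D-0151), road (P) of the d6 S2′ socket `SocketRos` (A-plan2 (g12) 2026-08-30T03:11:15Z: no `E`-rational divisor in the
theta class may be assumed at the levels of a unitary Shimura tower); count-neutral.  HC_CM is proved only modulo the 7 printed citations until
rung 0 closes.

## References
* [Milne1986AbelianVarieties] J. S. Milne, *Abelian varieties*, in Cornell–Silverman (eds.), *Arithmetic Geometry* (1986), §16, p. 131 (the pairings `ē_m`).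
* [Lang1983AbelianVarieties] S. Lang, *Abelian Varieties*, Ch. VII §2, Props. 2–3.
-/

universe u

open CategoryTheory CategoryTheory.Limits AlgebraicGeometry MonoidalCategory CartesianMonoidalCategory

noncomputable section

namespace Literature.AlgebraicGeometry.Motives

open scoped MonObj
open RatFn

namespace AbelianVariety

variable {K : Type u} [Field K] (L : Type u) [Field L] [Algebra K L] (P : AbelianVariety K)

/-- **`(gal σ⁻¹)^* (gal σ)^* Θ ∼ Θ`** (`gal σ⁻¹ ≫ gal σ = 𝟙`). [cite: Milne1986AbelianVarieties, §16 (p. 131, the pairings ē_m)] -/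
theorem pullback_galX_galX_symm_sameDivisor (Θ : CartierDivisor (P.baseChange L).X.left) (σ : L ≃ₐ[K] L) :
    ((Θ.pullback (P.galX L σ)).pullback (P.galX L σ⁻¹)).SameDivisor Θ := by
  haveI : IsDominant (P.galX L σ⁻¹ ≫ P.galX L σ) := inferInstance
  exact ((Θ.pullback_pullback_sameDivisor _ _).trans (Θ.pullback_congr_sameDivisor (P.galX_symm_comp_galX L σ))).trans
    Θ.pullback_id_sameDivisor

/-- **`D_{σ s}(Θ) ∼ (gal σ⁻¹)^* D_s((gal σ)^* Θ)`** for EVERY divisor `Θ` on `P_L`: `t_{σ s}^* Θ − Θ = (gal σ⁻¹ ≫ t_s ≫ gal σ)^* Θ − Θ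
∼ (gal σ⁻¹)^* (t_s^* (gal σ)^* Θ − (gal σ)^* Θ)` (★ `translation_smul_left`; no invariance of `Θ` is used).
[cite: Milne1986AbelianVarieties, §16 (p. 131, the pairings ē_m)] [cite: Lang1983AbelianVarieties, Ch. VII §2 Props. 2–3] -/
theorem weilDiv_smul_sameDivisor_pullback (Θ : CartierDivisor (P.baseChange L).X.left) (σ : L ≃ₐ[K] L)
    (s : P.Points L) :
    ((P.baseChange L).weilDiv Θ (P.pointsMulEquiv L (σ • s))).SameDivisor
      (((P.baseChange L).weilDiv (Θ.pullback (P.galX L σ)) (P.pointsMulEquiv L s)).pullback (P.galX L σ⁻¹)) := by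
  have ht := P.translation_smul_left L σ s
  haveI : IsDominant (((P.baseChange L).translation (P.pointsMulEquiv L s)).left ≫ P.galX L σ) :=
    inferInstance
  haveI : IsDominant (P.galX L σ⁻¹ ≫
      ((P.baseChange L).translation (P.pointsMulEquiv L s)).left ≫ P.galX L σ) := inferInstance
  -- `t_{σ s}^* Θ ∼ (gal σ⁻¹)^* t_s^* (gal σ)^* Θ`
  have h1 : (Θ.pullback ((P.baseChange L).translation (P.pointsMulEquiv L (σ • s))).left).SameDivisor
      (((Θ.pullback (P.galX L σ)).pullback ((P.baseChange L).translation (P.pointsMulEquiv L s)).left).pullback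
        (P.galX L σ⁻¹)) := by
    refine (Θ.pullback_congr_sameDivisor ht).trans ?_
    refine (Θ.pullback_pullback_sameDivisor _ _).symm.trans ?_
    refine CartierDivisor.SameDivisor.pullback _ ?_
    exact (Θ.pullback_pullback_sameDivisor _ _).symm
  -- `-Θ ∼ (gal σ⁻¹)^* (-(gal σ)^* Θ)`
  have h2 : (-Θ).SameDivisor ((-(Θ.pullback (P.galX L σ))).pullback (P.galX L σ⁻¹)) :=
    (P.pullback_galX_galX_symm_sameDivisor L Θ σ).symm.neg.trans
      (CartierDivisor.pullback_neg_sameDivisor _ (Θ.pullback (P.galX L σ))).symm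
  exact (h1.add h2).trans (CartierDivisor.pullback_add_sameDivisor _ _ _).symm

section Level

variable {N : ℕ} [IsDominant (Hom.toSchemeHom ((N : ℤ) • 𝟙 (P.baseChange L)))]

/-- **Galois transport of the level Weil pairing for an arbitrary divisor** (Milne 1986, §16, p. 131; Lang VII §2): for `σ ∈ Aut(L/K)`,
`r, s ∈ P(L)` with `r^N = s^N = 1` and ANY Cartier divisor `Θ` on `P_L`, **`ē_N^Θ(σ r, σ s) = σ (ē_N^{(gal σ)^* Θ}(r, s))`**.  Proof:
`(gal σ⁻¹)^♯ g`, `g` a trivializer of `[N]^* D_s((gal σ)^* Θ)`, trivializes `[N]^* D_{σ s}(Θ)` (`weilDiv_smul_sameDivisor_pullback`), and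
`t_{σ r}^♯ (gal σ⁻¹)^♯ g / (gal σ⁻¹)^♯ g = (gal σ⁻¹)^♯ (t_r^♯ g / g) = σ (ē^{(gal σ)^* Θ}(r, s))` on constants.
[cite: Milne1986AbelianVarieties, §16 (p. 131, the pairings ē_m)] [cite: Lang1983AbelianVarieties, Ch. VII §2 Props. 2–3] -/
theorem weilPairingLevel_galSmul_pullback (Θ : CartierDivisor (P.baseChange L).X.left) (σ : L ≃ₐ[K] L)
    {r s : P.Points L} (hr : r ^ N = 1) (hs : s ^ N = 1) :
    (P.baseChange L).weilPairingLevel Θ (P.torsionPt L (P.smul_pow_eq_one L σ hr))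
        (P.torsionPt L (P.smul_pow_eq_one L σ hs)) =
      σ ((P.baseChange L).weilPairingLevel (Θ.pullback (P.galX L σ)) (P.torsionPt L hr) (P.torsionPt L hs)) := by
  have hg : (P.baseChange L).IsTrivializer (n := N)
      ((P.baseChange L).weilDiv (Θ.pullback (P.galX L σ)) (P.pointsMulEquiv L s))
      ((P.baseChange L).weilFn (Θ.pullback (P.galX L σ)) (P.torsionPt L hs)) :=
    (P.baseChange L).isTrivializer_weilFn (Θ.pullback (P.galX L σ)) (P.torsionPt L hs)
  -- the transported trivializer of `[N]^* D_{σ s}(Θ)`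
  have hg' : (P.baseChange L).IsTrivializer (n := N)
      ((P.baseChange L).weilDiv Θ (P.pointsMulEquiv L (σ • s)))
      (functionFieldMap (P.galX L σ⁻¹) ((P.baseChange L).weilFn (Θ.pullback (P.galX L σ)) (P.torsionPt L hs))) :=
    (hg.gal L P σ⁻¹).of_sameDivisor (P.weilDiv_smul_sameDivisor_pullback L Θ σ s).symm
  rw [weilPairingLevel_eq_kummerConst (Q := P.torsionPt L (P.smul_pow_eq_one L σ hs)) hg'
    (P.torsionPt L (P.smul_pow_eq_one L σ hr))]
  apply (algebraMap L (P.baseChange L).X.left.functionField).injective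
  rw [algebraMap_kummerConst]
  -- `t_{σ r}^♯ = (gal σ⁻¹)^♯ ∘ t_r^♯ ∘ (gal σ)^♯`
  have ht := P.translation_smul_left L σ r
  haveI : IsDominant (((P.baseChange L).translation (P.pointsMulEquiv L r)).left ≫ P.galX L σ) :=
    inferInstance
  haveI : IsDominant (P.galX L σ⁻¹ ≫
      ((P.baseChange L).translation (P.pointsMulEquiv L r)).left ≫ P.galX L σ) := inferInstance
  have hFF : (P.baseChange L).translFF (P.pointsMulEquiv L (σ • r)) =
      (functionFieldMap (P.galX L σ⁻¹)).comp
        (((P.baseChange L).translFF (P.pointsMulEquiv L r)).comp (functionFieldMap (P.galX L σ))) := by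
    unfold translFF
    rw [functionFieldMap_congr ht, functionFieldMap_comp, functionFieldMap_comp]
  have hinv : ∀ f : (P.baseChange L).X.left.functionField,
      (functionFieldMap (P.galX L σ)) ((functionFieldMap (P.galX L σ⁻¹)) f) = f := fun f => by
    haveI : IsDominant (P.galX L σ ≫ P.galX L σ⁻¹) := inferInstance
    rw [← RingHom.comp_apply, ← functionFieldMap_comp,
      functionFieldMap_congr (P.galX_comp_galX_symm L σ), functionFieldMap_id, RingHom.id_apply]
  change (P.baseChange L).translFF (P.pointsMulEquiv L (σ • r))
      (functionFieldMap (P.galX L σ⁻¹) ((P.baseChange L).weilFn (Θ.pullback (P.galX L σ)) (P.torsionPt L hs))) /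
      functionFieldMap (P.galX L σ⁻¹) ((P.baseChange L).weilFn (Θ.pullback (P.galX L σ)) (P.torsionPt L hs)) = _
  rw [hFF, RingHom.comp_apply, RingHom.comp_apply, hinv, ← map_div₀,
    ← algebraMap_kummerConst hg (P.torsionPt L hr), functionFieldMap_galX_algebraMap, inv_inv]
  rfl

/-- **Galois equivariance from PAIRING-level invariance**: if `ē_N^{(gal σ)^* Θ} = ē_N^Θ` on `N`-torsion points, then
`ē_N^Θ(σ r, σ s) = σ (ē_N^Θ(r, s))` — the hypothesis a Galois-conjugate-up-to-translation divisor satisfies (the form of ★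
`weilPairingLevel_galSmul` without a Galois-invariant divisor). [cite: Milne1986AbelianVarieties, §16 (p. 131, the pairings ē_m)] -/
theorem weilPairingLevel_galSmul_of_pairing_invariant (Θ : CartierDivisor (P.baseChange L).X.left) (σ : L ≃ₐ[K] L)
    (hΘσ : ∀ R S : (P.baseChange L).torsionPoints L N,
      (P.baseChange L).weilPairingLevel (Θ.pullback (P.galX L σ)) R S = (P.baseChange L).weilPairingLevel Θ R S)
    {r s : P.Points L} (hr : r ^ N = 1) (hs : s ^ N = 1) :
    (P.baseChange L).weilPairingLevel Θ (P.torsionPt L (P.smul_pow_eq_one L σ hr))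
        (P.torsionPt L (P.smul_pow_eq_one L σ hs)) =
      σ ((P.baseChange L).weilPairingLevel Θ (P.torsionPt L hr) (P.torsionPt L hs)) := by
  rw [P.weilPairingLevel_galSmul_pullback L Θ σ hr hs, hΘσ]

end Level

end AbelianVariety

end Literature.AlgebraicGeometry.Motives

end
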